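import Mathlib
import HarnessLib
import Literature.MathematicalPhysics.StatisticalMechanics.BarlowStacking
import Literature.MathematicalPhysics.StatisticalMechanics.HaggStacking
import Literature.Geometry.DiscreteGeometry.KissingRigidity
import Literature.Geometry.DiscreteGeometry.LayerShells
import Summits.AtomisticToContinuum.Crystallization.Theorems.PricedLinkCensusSoftLayerPropagationOneStackingMapSearchDefs
import Summits.AtomisticToContinuum.Crystallization.Theorems.PricedLinkCensusSoftLayerPropagationOneStackingMapSearchLeaf
import Summits.AtomisticToContinuum.Crystallization.Theorems.PricedLinkCensusSoftLayerPropagationOneStackingMapSearchBasic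

/-!
# One-stacking map engine: Hägg sequences from letters, and the frames as Barlow frames

Route `PricedLinkCensus`, crux `SoftLayerPropagation` (stmt-AtomisticToContinuum-14233), line
`Sketch`, stub `stub_oneStackingMap`.  (1) From an admissible letter list `L` (`lettersOK`:
nine letters in `{0,1,2}`, letter `0` on layer `0`, consecutive letters different) the Hägg
sequence `haggOf L` (`+1` if the next letter is the cyclic successor, else `-1`) has
`haggLabel (haggOf L) k ≡ letter L k (mod 3)` for `|k| ≤ 4`.  (2) For each of the four frames
`F ∈ FRAMES` there is a linear isometry `Ψ` of `ℝ³` carrying the shadow vectors `toE3 F.t1`,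
`toE3 F.t2`, `toE3 F.w`, `toE3 F.z` to `√2 •` the Barlow frame `u = triangularVec₁ 1`,
`v = triangularVec₂ 1`, `w = barlowOffset 1`, `√(2/3) e₃ = layerNormal √(2/3)`; hence
`Ψ (toE3 (F.pt k a b c)) = √2 • (a u + b v + c w + k √(2/3) e₃)`.  All [folklore].
-/

noncomputable section

namespace Summit.AtomisticToContinuum.Crystallization.Theorems

namespace OneStacking

open Literature.MathematicalPhysics.StatisticalMechanics Literature.Geometry.DiscreteGeometry
open RealInnerProductSpace V3

/-! ### Hägg sequences from letters -/

/-- The Hägg sequence of a letter list: `+1` where the next letter is the cyclic successor,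
`-1` otherwise. [folklore] -/
def haggOf (L : List ℤ) (k : ℤ) : ℤ := if (St.letter L (k + 1) - St.letter L k) % 3 = 1 then 1 else -1

/-- `haggOf L` is a Hägg sequence. [folklore] -/
theorem isHaggSeq_haggOf (L : List ℤ) : IsHaggSeq (haggOf L) := by
  intro k; unfold haggOf; split_ifs <;> simp

/-- Decoding `lettersOK`. [folklore] -/
theorem lettersOK_spec {L : List ℤ} (h : St.lettersOK L = true) :
    St.letter L 0 = 0 ∧ (∀ k, -4 ≤ k → k ≤ 4 → 0 ≤ St.letter L k ∧ St.letter L k ≤ 2) ∧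
      (∀ k, -4 ≤ k → k ≤ 3 → St.letter L k ≠ St.letter L (k + 1)) := by
  simp only [St.lettersOK, Bool.and_eq_true, decide_eq_true_eq, List.all_eq_true, List.mem_range] at h
  obtain ⟨⟨⟨hlen, h0⟩, hall⟩, hdiff⟩ := h
  refine ⟨h0, fun k hk1 hk2 => ?_, fun k hk1 hk2 => ?_⟩
  · have hidx : (k + 4).toNat < L.length := by rw [hlen]; omega
    have hmem : L.getD (k + 4).toNat 0 ∈ L := by
      rw [List.getD_eq_getElem _ _ hidx]; exact List.getElem_mem hidx
    exact hall _ hmem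
  · have := hdiff (k + 4).toNat (by omega)
    simp only [St.letter]
    rwa [show (k + 1 + 4).toNat = (k + 4).toNat + 1 by omega]

/-- **Labels follow the letters**: `haggLabel (haggOf L) k ≡ letter L k (mod 3)` for `|k| ≤ 4`.
[folklore] -/
theorem haggLabel_haggOf {L : List ℤ} (h : St.lettersOK L = true) (k : ℤ) (hk1 : -4 ≤ k) (hk2 : k ≤ 4) :
    3 ∣ haggLabel (haggOf L) k - St.letter L k := by
  obtain ⟨h0, hrange, hdiff⟩ := lettersOK_spec h
  -- one step of the recursion, in divisibility form
  have step : ∀ m, -4 ≤ m → m ≤ 3 → 3 ∣ haggOf L m - (St.letter L (m + 1) - St.letter L m) := by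
    intro m hm1 hm2
    have hd := hdiff m hm1 hm2
    obtain ⟨ha1, ha2⟩ := hrange m hm1 (by omega)
    obtain ⟨hb1, hb2⟩ := hrange (m + 1) (by omega) (by omega)
    unfold haggOf
    split_ifs with hc <;> omega
  -- upwards and downwards from `0`
  have up : ∀ n : ℕ, n ≤ 4 → 3 ∣ haggLabel (haggOf L) n - St.letter L n := by
    intro n
    induction n with
    | zero => intro _; simp [h0]
    | succ n ih =>
      intro hn
      have h1 := ih (by omega)
      have h2 := step n (by omega) (by omega)
      rw [Nat.cast_succ, haggLabel_succ]
      omega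
  have down : ∀ n : ℕ, n ≤ 4 → 3 ∣ haggLabel (haggOf L) (-(n : ℤ)) - St.letter L (-(n : ℤ)) := by
    intro n
    induction n with
    | zero => intro _; simp [h0]
    | succ n ih =>
      intro hn
      have h1 := ih (by omega)
      have h2 := step (-((n : ℤ) + 1)) (by omega) (by omega)
      have h3 := haggLabel_succ (haggOf L) (-((n : ℤ) + 1))
      rw [show -((n : ℤ) + 1) + 1 = -(n : ℤ) by ring] at h2 h3
      rw [Nat.cast_succ]
      omega
  rcases le_or_gt 0 k with hk | hk
  · obtain ⟨n, rfl⟩ : ∃ n : ℕ, k = n := ⟨k.toNat, by omega⟩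
    exact up n (by omega)
  · obtain ⟨n, rfl⟩ : ∃ n : ℕ, k = -(n : ℤ) := ⟨(-k).toNat, by omega⟩
    exact down n (by omega)

/-! ### The Barlow frame at scale `1` -/

/-- `u = (1, 0, 0)`. -/
local notation "𝐮" => triangularVec₁ (1 : ℝ)
/-- `v = (1/2, √3/2, 0)`. -/
local notation "𝐯" => triangularVec₂ (1 : ℝ)
/-- `w = (1/2, √3/6, 0)`. -/
local notation "𝐰" => barlowOffset (1 : ℝ)
/-- `√(2/3) e₃`. -/
local notation "𝐞" => layerNormal (Real.sqrt (2 / 3))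

/-- Gram entries of the frame at scale `1`. [folklore] -/
theorem gram_frame :
    ⟪(𝐮 : E3), 𝐮⟫ = 1 ∧ ⟪(𝐮 : E3), 𝐯⟫ = 1 / 2 ∧ ⟪(𝐯 : E3), 𝐯⟫ = 1 ∧ ⟪(𝐮 : E3), 𝐞⟫ = 0 ∧ ⟪(𝐯 : E3), 𝐞⟫ = 0 ∧
      ⟪(𝐞 : E3), 𝐞⟫ = 2 / 3 := by
  set r := Real.sqrt (2 / 3) with hr
  have hr2 : r * r = 2 / 3 := Real.mul_self_sqrt (by norm_num)
  have h3 : Real.sqrt 3 * Real.sqrt 3 = 3 := Real.mul_self_sqrt (by norm_num)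
  simp only [inner_fin3, triangularVec₁, triangularVec₂, layerNormal, Matrix.cons_val_zero,
    Matrix.cons_val_one, Matrix.cons_val]
  refine ⟨by norm_num, by norm_num, ?_, by norm_num, by norm_num, ?_⟩
  · simp; nlinarith [h3]
  · simp; nlinarith [hr2]

/-- Integer Gram data of the four frames (with `p₁ = 2t₂ − t₁`): `t₁·t₁ = 2S²`, `t₁·p₁ = 0`,
`p₁·p₁ = 6S²`, `t₁·z = p₁·z = 0`, `3 z·z = 4S²`, and `3w = t₁ + t₂`. [folklore] -/
theorem frame_table : ∀ F ∈ St.FRAMES,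
    dot F.t1 F.t1 = NN2 ∧ dot F.t1 (sub (smul 2 F.t2) F.t1) = 0 ∧
    dot (sub (smul 2 F.t2) F.t1) (sub (smul 2 F.t2) F.t1) = 3 * NN2 ∧
    dot F.t1 F.z = 0 ∧ dot (sub (smul 2 F.t2) F.t1) F.z = 0 ∧ 3 * dot F.z F.z = 2 * NN2 ∧
    smul 3 F.w = add F.t1 F.t2 := by
  decide

set_option maxHeartbeats 400000 in
/-- **The frames are Barlow frames**: a linear isometry carries `toE3 t₁, toE3 t₂, toE3 w, toE3 z`
to `√2 •` the Barlow frame `u, v, w, √(2/3) e₃`. [folklore] -/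
theorem exists_frame_isometry {F : St.Frame} (hF : F ∈ St.FRAMES) : ∃ Ψ : E3 →ₗᵢ[ℝ] E3,
    Ψ (toE3 F.t1) = Real.sqrt 2 • (𝐮 : E3) ∧ Ψ (toE3 F.t2) = Real.sqrt 2 • (𝐯 : E3) ∧
      Ψ (toE3 F.w) = Real.sqrt 2 • (𝐰 : E3) ∧ Ψ (toE3 F.z) = Real.sqrt 2 • (𝐞 : E3) := by
  obtain ⟨h11, h1p, hpp, h1z, hpz, hzz, hw⟩ := frame_table F hF
  obtain ⟨guu, guv, gvv, gue, gve, gee⟩ := gram_frame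
  have sqrt2_mul_self : Real.sqrt 2 * Real.sqrt 2 = 2 := Real.mul_self_sqrt (by norm_num)
  have hS := S_real.1
  -- the shadow triple and its Gram entries
  set p : Fin 3 → E3 := ![toE3 F.t1, toE3 (sub (smul 2 F.t2) F.t1), toE3 F.z] with hp
  have cNN2 : ((NN2 : ℤ) : ℝ) = 2 * S * S := by simp [NN2]
  have p00 : ⟪p 0, p 0⟫ = 2 := by
    show ⟪toE3 F.t1, toE3 F.t1⟫ = 2
    rw [inner_toE3, h11, cNN2]; field_simp
  have p01 : ⟪p 0, p 1⟫ = 0 := by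
    show ⟪toE3 F.t1, toE3 (sub (smul 2 F.t2) F.t1)⟫ = 0
    rw [inner_toE3, h1p]; simp
  have p11 : ⟪p 1, p 1⟫ = 6 := by
    have : ((3 * NN2 : ℤ) : ℝ) = 6 * S * S := by push_cast; rw [cNN2]; ring
    show ⟪toE3 (sub (smul 2 F.t2) F.t1), toE3 (sub (smul 2 F.t2) F.t1)⟫ = 6
    rw [inner_toE3, hpp, this]; field_simp
  have p02 : ⟪p 0, p 2⟫ = 0 := by
    show ⟪toE3 F.t1, toE3 F.z⟫ = 0
    rw [inner_toE3, h1z]; simp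
  have p12 : ⟪p 1, p 2⟫ = 0 := by
    show ⟪toE3 (sub (smul 2 F.t2) F.t1), toE3 F.z⟫ = 0
    rw [inner_toE3, hpz]; simp
  have p22 : ⟪p 2, p 2⟫ = 4 / 3 := by
    have : ((dot F.z F.z : ℤ) : ℝ) = 4 / 3 * S * S := by
      have e : ((3 * dot F.z F.z : ℤ) : ℝ) = ((2 * NN2 : ℤ) : ℝ) := by rw [hzz]
      push_cast at e; rw [cNN2] at e; linarith
    show ⟪toE3 F.z, toE3 F.z⟫ = 4 / 3
    rw [inner_toE3, this]; field_simp
  -- the Barlow triple and its Gram entries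
  set q : Fin 3 → E3 := ![Real.sqrt 2 • (𝐮 : E3), Real.sqrt 2 • ((2 : ℝ) • 𝐯 - 𝐮), Real.sqrt 2 • 𝐞] with hq
  have gvu : ⟪(𝐯 : E3), 𝐮⟫ = 1 / 2 := by rw [real_inner_comm]; exact guv
  have geu : ⟪(𝐞 : E3), 𝐮⟫ = 0 := by rw [real_inner_comm]; exact gue
  have gev : ⟪(𝐞 : E3), 𝐯⟫ = 0 := by rw [real_inner_comm]; exact gve
  have q00 : ⟪q 0, q 0⟫ = 2 := by
    show ⟪Real.sqrt 2 • (𝐮 : E3), Real.sqrt 2 • (𝐮 : E3)⟫ = 2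
    simp only [real_inner_smul_left, real_inner_smul_right, guu]; nlinarith [sqrt2_mul_self]
  have q01 : ⟪q 0, q 1⟫ = 0 := by
    show ⟪Real.sqrt 2 • (𝐮 : E3), Real.sqrt 2 • ((2 : ℝ) • 𝐯 - 𝐮)⟫ = 0
    simp only [real_inner_smul_left, real_inner_smul_right, inner_sub_right, guu, guv]; ring
  have q11 : ⟪q 1, q 1⟫ = 6 := by
    show ⟪Real.sqrt 2 • ((2 : ℝ) • (𝐯 : E3) - 𝐮), Real.sqrt 2 • ((2 : ℝ) • 𝐯 - 𝐮)⟫ = 6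
    simp only [real_inner_smul_left, real_inner_smul_right, inner_sub_left, inner_sub_right, guu, guv, gvu, gvv]
    nlinarith [sqrt2_mul_self]
  have q02 : ⟪q 0, q 2⟫ = 0 := by
    show ⟪Real.sqrt 2 • (𝐮 : E3), Real.sqrt 2 • (𝐞 : E3)⟫ = 0
    simp only [real_inner_smul_left, real_inner_smul_right, gue]; ring
  have q12 : ⟪q 1, q 2⟫ = 0 := by
    show ⟪Real.sqrt 2 • ((2 : ℝ) • (𝐯 : E3) - 𝐮), Real.sqrt 2 • (𝐞 : E3)⟫ = 0
    simp only [real_inner_smul_left, real_inner_smul_right, inner_sub_left, gue, gve]; ring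
  have q22 : ⟪q 2, q 2⟫ = 4 / 3 := by
    show ⟪Real.sqrt 2 • (𝐞 : E3), Real.sqrt 2 • (𝐞 : E3)⟫ = 4 / 3
    simp only [real_inner_smul_left, real_inner_smul_right, gee]; nlinarith [sqrt2_mul_self]
  have p10 : ⟪p 1, p 0⟫ = 0 := by rw [real_inner_comm]; exact p01
  have p20 : ⟪p 2, p 0⟫ = 0 := by rw [real_inner_comm]; exact p02
  have p21 : ⟪p 2, p 1⟫ = 0 := by rw [real_inner_comm]; exact p12
  have q10 : ⟪q 1, q 0⟫ = 0 := by rw [real_inner_comm]; exact q01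
  have q20 : ⟪q 2, q 0⟫ = 0 := by rw [real_inner_comm]; exact q02
  have q21 : ⟪q 2, q 1⟫ = 0 := by rw [real_inner_comm]; exact q12
  have hpq : ∀ a b : Fin 3, ⟪p a, p b⟫ = ⟪q a, q b⟫ := by
    intro a b
    fin_cases a <;> fin_cases b
    · exact p00.trans q00.symm
    · exact p01.trans q01.symm
    · exact p02.trans q02.symm
    · exact p10.trans q10.symm
    · exact p11.trans q11.symm
    · exact p12.trans q12.symm
    · exact p20.trans q20.symm
    · exact p21.trans q21.symm
    · exact p22.trans q22.symm
  -- independence of the shadow triple (orthogonal, non-zero)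
  have hli : LinearIndependent ℝ p := by
    apply linearIndependent_of_ne_zero_of_inner_eq_zero
    · intro a h0
      have key : ⟪p a, p a⟫ ≠ 0 := by
        fin_cases a
        · exact fun h => by have := p00.symm.trans h; norm_num at this
        · exact fun h => by have := p11.symm.trans h; norm_num at this
        · exact fun h => by have := p22.symm.trans h; norm_num at this
      exact key (by rw [h0, inner_zero_left])
    · intro a b hab
      fin_cases a <;> fin_cases b
      · exact absurd rfl hab
      · exact p01
      · exact p02
      · exact p10
      · exact absurd rfl hab
      · exact p12
      · exact p20
      · exact p21
      · exact absurd rfl hab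
  obtain ⟨Ψ, hΨ⟩ := exists_linearIsometry_of_inner_eq hli hpq
  have hΨ0 : Ψ (toE3 F.t1) = Real.sqrt 2 • (𝐮 : E3) := hΨ 0
  have hΨ2 : Ψ (toE3 F.z) = Real.sqrt 2 • (𝐞 : E3) := hΨ 2
  have hΨ1' : Ψ (toE3 (sub (smul 2 F.t2) F.t1)) = Real.sqrt 2 • ((2 : ℝ) • 𝐯 - 𝐮) := hΨ 1
  have hΨ1 : Ψ (toE3 F.t2) = Real.sqrt 2 • (𝐯 : E3) := by
    have e : toE3 F.t2 = (2 : ℝ)⁻¹ • (toE3 F.t1 + toE3 (sub (smul 2 F.t2) F.t1)) := by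
      rw [toE3_sub, toE3_smul, Int.cast_ofNat, _root_.add_sub_cancel, smul_smul, inv_mul_cancel₀ two_ne_zero, one_smul]
    have e2 : Real.sqrt 2 • (𝐮 : E3) + Real.sqrt 2 • ((2 : ℝ) • 𝐯 - 𝐮) = (2 : ℝ) • (Real.sqrt 2 • (𝐯 : E3)) := by
      module
    rw [e, map_smul, map_add, hΨ0, hΨ1', e2, smul_smul, inv_mul_cancel₀ two_ne_zero, one_smul]
  refine ⟨Ψ, hΨ0, hΨ1, ?_, hΨ2⟩
  have e : toE3 F.w = (3 : ℝ)⁻¹ • (toE3 F.t1 + toE3 F.t2) := by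
    rw [← toE3_add, ← hw, toE3_smul, Int.cast_ofNat, smul_smul, inv_mul_cancel₀ three_ne_zero, one_smul]
  have e3 : Real.sqrt 2 • (𝐮 : E3) + Real.sqrt 2 • (𝐯 : E3) = (3 : ℝ) • (Real.sqrt 2 • (𝐰 : E3)) := by
    rw [← smul_add, ← three_smul_barlowOffset]; module
  rw [e, map_smul, map_add, hΨ0, hΨ1, e3, smul_smul, inv_mul_cancel₀ three_ne_zero, one_smul]

/-- **Stacking points of a frame are Barlow points**: `Ψ (toE3 (F.pt k a b c)) =
√2 • (a u + b v + c w + k √(2/3) e₃)`. [folklore] -/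
theorem frame_pt {F : St.Frame} {Ψ : E3 →ₗᵢ[ℝ] E3}
    (h1 : Ψ (toE3 F.t1) = Real.sqrt 2 • (𝐮 : E3)) (h2 : Ψ (toE3 F.t2) = Real.sqrt 2 • (𝐯 : E3))
    (hw : Ψ (toE3 F.w) = Real.sqrt 2 • (𝐰 : E3)) (hz : Ψ (toE3 F.z) = Real.sqrt 2 • (𝐞 : E3)) (k a b c : ℤ) :
    Ψ (toE3 (F.pt k a b c)) =
      Real.sqrt 2 • ((a : ℝ) • (𝐮 : E3) + (b : ℝ) • 𝐯 + (c : ℝ) • 𝐰 + (k : ℝ) • 𝐞) := by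
  simp only [St.Frame.pt, toE3_add, toE3_smul, map_add, LinearIsometry.map_smul, h1, h2, hw, hz, smul_add]
  simp only [smul_comm _ (Real.sqrt 2)]

end OneStacking

end Summit.AtomisticToContinuum.Crystallization.Theorems
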